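import Mathlib
import Summits.Ventures.PercRepro2.TypedDomainInstance

/-!
# p3 g7's (HARRIS-1) instance, I: the twelve conditions of `ResidualCoreNHatCTBRASUDO7` (blind cell
PercRepro2, p2 g7, 2026-08-26; the lead's RULING 1 of 00:44:30Z — «hand-checked, the lead / p2 to
confirm in Lean»)

The 15-edge instance on 9 vertices announced with the o-pocket class on the doors `{a₁, b}`:
vertices `0 = o, 1 = a₁, 2 = a₂, 3 = a₃, 4 = b, 5 = u, 6 = w, 7 = y, 8 = z`, typed edges
`o–u, o–w, u–w, u–a₁, u–b, w–a₁, w–b | y–a₁, y–a₂, y–a₃, y–b, z–a₁, z–a₂, z–a₃, z–b` (`F = univ`,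
`z ≡ false`).  **`instanceH1_mem12`**: the instance satisfies the twelve conditions of
`ResidualCoreNHatCTBRASUDO7` — the decidable ones by `decide +kernel`, the `Set`-quantified ones
(the cuts, the two-terminal parts, the root bundles) by attachment / path arguments (the paths
`b–y–a₂`, `b–y–a₁` avoid the root cuts; `u` has typed edges to the three distinct marks `o, a₁, b`,
`y` and `z` to `a₁, a₂, a₃`), the two «no configuration below `F`» conditions by explicit
configurations.  The four separator conditions (the sixteen in all) are in
TypedDomainInstanceH1Sep.lean.  Method of TypedDomainInstance.lean.  Own code; standard axioms.
-/

namespace Summit.Ventures.PercRepro2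

open UnionCluster

namespace CovForm

namespace TypedRed

namespace NonVacuityH1

open Separated (zF)
open NonVacuity (ends_mem_of_within unmarked_cases mark_not_mem)

/-- p3 g7's (HARRIS-1) instance: `0 = o, 1 = a₁, 2 = a₂, 3 = a₃, 4 = b, 5 = u, 6 = w, 7 = y, 8 = z`;
edges `0 = o–u, 1 = o–w, 2 = u–w, 3 = u–a₁, 4 = u–b, 5 = w–a₁, 6 = w–b, 7 = y–a₁, 8 = y–a₂,
9 = y–a₃, 10 = y–b, 11 = z–a₁, 12 = z–a₂, 13 = z–a₃, 14 = z–b`. -/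
def endsH1 : Fin 15 → Sym2 (Fin 9) :=
  ![s(0, 5), s(0, 6), s(5, 6), s(5, 1), s(5, 4), s(6, 1), s(6, 4), s(7, 1), s(7, 2), s(7, 3),
    s(7, 4), s(8, 1), s(8, 2), s(8, 3), s(8, 4)]

/-- Its typed edge set: every edge. -/
abbrev FH1 : Finset (Fin 15) := Finset.univ

/-! ## The decidable conditions -/

set_option synthInstance.maxHeartbeats 400000
set_option synthInstance.maxSize 1024

/-- The instance is fully reduced. -/
theorem reducedH1 : Reduced endsH1 0 1 2 3 4 FH1 := by
  refine ⟨?_, ?_, ?_, ?_, ?_, ?_, ?_⟩ <;> decide +kernel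

/-- The instance is residual. -/
theorem residualH1 : Residual endsH1 0 1 2 3 4 FH1 :=
  ⟨reducedH1, by decide, by decide +kernel, by decide +kernel, by decide +kernel, by decide +kernel⟩

/-- The roots are joined. -/
theorem conH1 : Conn endsH1 (typedConfig FH1) 1 2 := by decide +kernel

/-- Every typed edge is root-reachable. -/
theorem rootReachH1 : ∀ e ∈ FH1, ∃ p ∈ endsH1 e,
    Conn endsH1 (typedConfig FH1) 1 p ∨ Conn endsH1 (typedConfig FH1) 2 p := by decide +kernel

/-- No same-side root bridge. -/
theorem noBridgeH1 : ¬ RootBridge.HasRootBridgeSameSide' endsH1 0 1 2 4 FH1 := by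
  simp only [RootBridge.HasRootBridgeSameSide', mem_cluster]; decide +kernel

/-- The core of the domain. -/
theorem coreH1 : ResidualCore endsH1 0 1 2 3 4 FH1 :=
  ⟨⟨⟨residualH1, conH1⟩, rootReachH1⟩, noBridgeH1, NonVacuity.marks13⟩

/-- `u = 5` is not a hat (four typed edges). -/
theorem notHat5 : ¬ IsHat endsH1 0 1 2 3 4 FH1 5 := by
  unfold IsHat; decide +kernel

/-- Not every unmarked typed vertex is a hat. -/
theorem noHatsH1 : ¬ Hats endsH1 0 1 2 3 4 FH1 := fun h =>
  notHat5 (h 5 (by decide) (by decide) (by decide) (by decide) (by decide) ⟨0, by decide, by decide⟩)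

/-- Among any three edges, one of the fifteen is left over, with an unmarked end. -/
theorem key_star : ∀ e₁ e₂ e₃ : Fin 15, ∃ e : Fin 15, e ≠ e₁ ∧ e ≠ e₂ ∧ e ≠ e₃ ∧
    ∃ v : Fin 9, v ∈ endsH1 e ∧ v ≠ 0 ∧ v ≠ 1 ∧ v ≠ 2 ∧ v ≠ 3 ∧ v ≠ 4 := by decide +kernel

/-- Not a one-star. -/
theorem noOneStarH1 : ¬ OneStar endsH1 0 1 2 3 4 FH1 := by
  rintro ⟨u, v₁, v₂, v₃, e₁, e₂, e₃, -, -, -, -, -, -, -, -, -, -, -, -, -, -, hall⟩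
  obtain ⟨e, h1, h2, h3, v, hv, hv0, hv1, hv2, hv3, hv4⟩ := key_star e₁ e₂ e₃
  rcases hall e (Finset.mem_univ e) h1 h2 h3 v hv with h | h | h | h | h <;> contradiction

/-! ## The cuts -/

/-- The typed configuration at `z ≡ false` is every edge open. -/
theorem zFH1 (e : Fin 15) : zF FH1 (fun _ => false) e = true := by
  simp [Separated.zF]

/-- No cut at the root `a₁`: the path `b–y–a₂` avoids it. -/
theorem noCutA1 : ¬ RootBridge.HasCutAtRoot endsH1 0 1 2 3 4 FH1 := by
  rintro ⟨VL, VH, hc⟩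
  have hb : (4 : Fin 9) ∉ VH := fun h => by have := hc.cap 4 hc.bL h; exact absurd this (by decide)
  have h2 : (2 : Fin 9) ∉ VL := fun h => by have := hc.cap 2 h hc.a2H; exact absurd this (by decide)
  have e10 := hc.split 10 (zFH1 10)
  have e8 := hc.split 8 (zFH1 8)
  rcases e10 with w10 | w10
  · have h7L := (ends_mem_of_within (x := 7) (y := 4) rfl w10).1
    rcases e8 with w8 | w8
    · exact h2 (ends_mem_of_within (x := 7) (y := 2) rfl w8).2
    · have h7H := (ends_mem_of_within (x := 7) (y := 2) rfl w8).1
      have := hc.cap 7 h7L h7H; exact absurd this (by decide)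
  · exact hb (ends_mem_of_within (x := 7) (y := 4) rfl w10).2

/-- No cut at the root `a₂` (the roots swapped): the path `b–y–a₁` avoids it. -/
theorem noCutA2 : ¬ RootBridge.HasCutAtRoot endsH1 0 2 1 3 4 FH1 := by
  rintro ⟨VL, VH, hc⟩
  have hb : (4 : Fin 9) ∉ VH := fun h => by have := hc.cap 4 hc.bL h; exact absurd this (by decide)
  have h1 : (1 : Fin 9) ∉ VL := fun h => by have := hc.cap 1 h hc.a2H; exact absurd this (by decide)
  have e10 := hc.split 10 (zFH1 10)
  have e7 := hc.split 7 (zFH1 7)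
  rcases e10 with w10 | w10
  · have h7L := (ends_mem_of_within (x := 7) (y := 4) rfl w10).1
    rcases e7 with w7 | w7
    · exact h1 (ends_mem_of_within (x := 7) (y := 1) rfl w7).2
    · have h7H := (ends_mem_of_within (x := 7) (y := 1) rfl w7).1
      have := hc.cap 7 h7L h7H; exact absurd this (by decide)
  · exact hb (ends_mem_of_within (x := 7) (y := 4) rfl w10).2

/-- No root cut. -/
theorem noRootCutH1 : ¬ HasRootCut endsH1 0 1 2 3 4 FH1 := by
  rintro (h | h)
  · exact noCutA1 h
  · exact noCutA2 h

/-- No cut-roots class (`M_H = ∅`): `y` and `z` would both be the cut vertex. -/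
theorem noCutRootsH1 : ¬ RootBridge.HasCutRoots endsH1 0 1 2 3 4 FH1 := by
  rintro ⟨c, VL, VH, hc⟩
  have h1 : (1 : Fin 9) ∉ VL := fun h => hc.a1c (hc.cap 1 h hc.a1H)
  have hb : (4 : Fin 9) ∉ VH := fun h => hc.bc (hc.cap 4 hc.bL h)
  -- `y = 7` is the cut vertex
  have hy : (7 : Fin 9) = c := by
    have e10 := hc.split 10 (zFH1 10)
    have e7 := hc.split 7 (zFH1 7)
    have h7L : (7 : Fin 9) ∈ VL := by
      rcases e10 with w | w
      · exact (ends_mem_of_within (x := 7) (y := 4) rfl w).1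
      · exact absurd (ends_mem_of_within (x := 7) (y := 4) rfl w).2 hb
    rcases e7 with w | w
    · exact absurd (ends_mem_of_within (x := 7) (y := 1) rfl w).2 h1
    · exact hc.cap 7 h7L (ends_mem_of_within (x := 7) (y := 1) rfl w).1
  -- and so is `z = 8`
  have hz : (8 : Fin 9) = c := by
    have e14 := hc.split 14 (zFH1 14)
    have e11 := hc.split 11 (zFH1 11)
    have h8L : (8 : Fin 9) ∈ VL := by
      rcases e14 with w | w
      · exact (ends_mem_of_within (x := 8) (y := 4) rfl w).1
      · exact absurd (ends_mem_of_within (x := 8) (y := 4) rfl w).2 hb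
    rcases e11 with w | w
    · exact absurd (ends_mem_of_within (x := 8) (y := 1) rfl w).2 h1
    · exact hc.cap 8 h8L (ends_mem_of_within (x := 8) (y := 1) rfl w).1
  exact absurd (hy.trans hz.symm) (by decide)

/-- No cut-roots-`a₃` class (`M_H = {a₃}`): `y` and `z` would both be the cut vertex. -/
theorem noCutRootsA3_H1 : ¬ RootBridge.HasCutRootsA3 endsH1 0 1 2 3 4 FH1 := by
  rintro ⟨c, VL, VH, hc⟩
  have h1 : (1 : Fin 9) ∉ VL := fun h => hc.a1c (hc.cap 1 h hc.a1H)
  have hb : (4 : Fin 9) ∉ VH := fun h => hc.bc (hc.cap 4 hc.bL h)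
  have hy : (7 : Fin 9) = c := by
    have e10 := hc.split 10 (zFH1 10)
    have e7 := hc.split 7 (zFH1 7)
    have h7L : (7 : Fin 9) ∈ VL := by
      rcases e10 with w | w
      · exact (ends_mem_of_within (x := 7) (y := 4) rfl w).1
      · exact absurd (ends_mem_of_within (x := 7) (y := 4) rfl w).2 hb
    rcases e7 with w | w
    · exact absurd (ends_mem_of_within (x := 7) (y := 1) rfl w).2 h1
    · exact hc.cap 7 h7L (ends_mem_of_within (x := 7) (y := 1) rfl w).1
  have hz : (8 : Fin 9) = c := by
    have e14 := hc.split 14 (zFH1 14)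
    have e11 := hc.split 11 (zFH1 11)
    have h8L : (8 : Fin 9) ∈ VL := by
      rcases e14 with w | w
      · exact (ends_mem_of_within (x := 8) (y := 4) rfl w).1
      · exact absurd (ends_mem_of_within (x := 8) (y := 4) rfl w).2 hb
    rcases e11 with w | w
    · exact absurd (ends_mem_of_within (x := 8) (y := 1) rfl w).2 h1
    · exact hc.cap 8 h8L (ends_mem_of_within (x := 8) (y := 1) rfl w).1
  exact absurd (hy.trans hz.symm) (by decide)

/-! ## The two-terminal parts and the root bundles -/

/-- Witnesses: three typed edges at each unmarked vertex and their marked other ends. -/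
def wit3 : Fin 9 → (Fin 15 × Fin 15 × Fin 15) × (Fin 9 × Fin 9 × Fin 9)
  | 5 => ((0, 3, 4), (0, 1, 4))
  | 6 => ((1, 5, 6), (0, 1, 4))
  | 7 => ((7, 8, 9), (1, 2, 3))
  | 8 => ((11, 12, 13), (1, 2, 3))
  | _ => ((0, 0, 0), (0, 0, 0))

/-- Three typed edges at each unmarked vertex, with three distinct marked other ends. -/
theorem three_marks : ∀ x : Fin 9, x = 5 ∨ x = 6 ∨ x = 7 ∨ x = 8 →
    endsH1 (wit3 x).1.1 = s(x, (wit3 x).2.1) ∧ endsH1 (wit3 x).1.2.1 = s(x, (wit3 x).2.2.1) ∧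
      endsH1 (wit3 x).1.2.2 = s(x, (wit3 x).2.2.2) ∧
      (wit3 x).2.1 ≠ (wit3 x).2.2.1 ∧ (wit3 x).2.1 ≠ (wit3 x).2.2.2 ∧ (wit3 x).2.2.1 ≠ (wit3 x).2.2.2 ∧
      ((wit3 x).2.1 = 0 ∨ (wit3 x).2.1 = 1 ∨ (wit3 x).2.1 = 2 ∨ (wit3 x).2.1 = 3 ∨ (wit3 x).2.1 = 4) ∧
      ((wit3 x).2.2.1 = 0 ∨ (wit3 x).2.2.1 = 1 ∨ (wit3 x).2.2.1 = 2 ∨ (wit3 x).2.2.1 = 3 ∨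
        (wit3 x).2.2.1 = 4) ∧
      ((wit3 x).2.2.2 = 0 ∨ (wit3 x).2.2.2 = 1 ∨ (wit3 x).2.2.2 = 2 ∨ (wit3 x).2.2.2 = 3 ∨
        (wit3 x).2.2.2 = 4) := by decide +kernel

/-- Witnesses: two typed edges at each unmarked vertex whose other ends are distinct non-root marks. -/
def wit2 : Fin 9 → (Fin 15 × Fin 15) × (Fin 9 × Fin 9)
  | 5 => ((0, 4), (0, 4))
  | 6 => ((1, 6), (0, 4))
  | 7 => ((9, 10), (3, 4))
  | 8 => ((13, 14), (3, 4))
  | _ => ((0, 0), (0, 0))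

/-- Two typed edges at each unmarked vertex whose other ends are two distinct non-root marks. -/
theorem two_nonroot_marks : ∀ x : Fin 9, x = 5 ∨ x = 6 ∨ x = 7 ∨ x = 8 →
    endsH1 (wit2 x).1.1 = s(x, (wit2 x).2.1) ∧ endsH1 (wit2 x).1.2 = s(x, (wit2 x).2.2) ∧
      (wit2 x).2.1 ≠ (wit2 x).2.2 ∧
      ((wit2 x).2.1 = 0 ∨ (wit2 x).2.1 = 3 ∨ (wit2 x).2.1 = 4) ∧
      ((wit2 x).2.2 = 0 ∨ (wit2 x).2.2 = 3 ∨ (wit2 x).2.2 = 4) := by decide +kernel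

/-- An edge with both ends in `{s, t}` is the edge `s–t` (no loops). -/
theorem edge_of_ends_in_pair : ∀ e : Fin 15, ∀ s t : Fin 9,
    (∀ v : Fin 9, v ∈ endsH1 e → v = s ∨ v = t) → endsH1 e = s(s, t) := by decide +kernel

/-- No two distinct typed edges are parallel. -/
theorem no_parallelH1 : ∀ e f : Fin 15, e ≠ f → endsH1 e ≠ endsH1 f := by decide +kernel

/-- An edge with both ends in `{v, a₁, a₂}` is `v–a₁` or `v–a₂` (no loops, no root pair). -/
theorem edge_of_ends_in_triple : ∀ e : Fin 15, ∀ v : Fin 9,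
    (∀ x : Fin 9, x ∈ endsH1 e → x = v ∨ x = 1 ∨ x = 2) → endsH1 e = s(v, 1) ∨ endsH1 e = s(v, 2) := by
  decide +kernel

/-- At most two typed edges join `v` to the roots. -/
theorem card_root_edges_le_two : ∀ v : Fin 9,
    (Finset.univ.filter fun e : Fin 15 => endsH1 e = s(v, 1) ∨ endsH1 e = s(v, 2)).card ≤ 2 := by
  decide +kernel

/-- No two-terminal part. -/
theorem noTwoTerminalH1 : ¬ HasTwoTerminalPart endsH1 0 1 2 3 4 FH1 := by
  rintro ⟨I, s, t, L, h⟩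
  by_cases hI : ∃ x, x ∈ I
  · obtain ⟨x, hx⟩ := hI
    obtain ⟨hx0, hx1, hx2, hx3, hx4⟩ := h.unmarked x hx
    obtain ⟨he₁, he₂, he₃, h12, h13, h23, hm₁, hm₂, hm₃⟩ :=
      three_marks x (unmarked_cases x hx0 hx1 hx2 hx3 hx4)
    -- the three edges are in `L` (they are typed edges at `x ∈ I`)
    have inL : ∀ e : Fin 15, ∀ m : Fin 9, endsH1 e = s(x, m) → e ∈ L := fun e m he => by
      by_contra hL
      exact h.closed e hL ⟨x, hx, by rw [he]; exact Sym2.mem_mk_left x m⟩ (Finset.mem_univ e)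
    -- their other ends are marks, hence not in `I`, hence `s` or `t`
    have st : ∀ e : Fin 15, ∀ m : Fin 9, endsH1 e = s(x, m) →
        (m = 0 ∨ m = 1 ∨ m = 2 ∨ m = 3 ∨ m = 4) → m = s ∨ m = t := fun e m he hm => by
      rcases h.ends_in e (inL e m he) m (by rw [he]; exact Sym2.mem_mk_right x m) with hI' | hs | ht
      · exact absurd hI' (mark_not_mem h.unmarked hm)
      · exact Or.inl hs
      · exact Or.inr ht
    have s1 := st _ _ he₁ hm₁
    have s2 := st _ _ he₂ hm₂
    have s3 := st _ _ he₃ hm₃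
    rcases s1 with h1 | h1 <;> rcases s2 with h2 | h2 <;> rcases s3 with h3 | h3 <;>
      first | exact h12 (h1.trans h2.symm) | exact h13 (h1.trans h3.symm) | exact h23 (h2.trans h3.symm)
  · -- `I = ∅`: two distinct typed edges with both ends in `{s, t}` would be parallel
    push Not at hI
    obtain ⟨e, he, f, hf, hef⟩ := Finset.one_lt_card.1 h.two_le
    have pair : ∀ g ∈ L, endsH1 g = s(s, t) := fun g hg =>
      edge_of_ends_in_pair g s t fun v hv => by
        rcases h.ends_in g hg v hv with hI' | hs | ht
        · exact absurd hI' (hI v)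
        · exact Or.inl hs
        · exact Or.inr ht
    exact no_parallelH1 e f hef ((pair e he).trans (pair f hf).symm)

/-- No root bundle. -/
theorem noRootBundleH1 : ¬ HasRootBundle endsH1 0 1 2 3 4 FH1 := by
  rintro ⟨I, v, L, h⟩
  by_cases hI : ∃ x, x ∈ I
  · obtain ⟨x, hx⟩ := hI
    obtain ⟨hx0, hx1, hx2, hx3, hx4⟩ := h.unmarked x hx
    obtain ⟨he₁, he₂, h12, hm₁, hm₂⟩ :=
      two_nonroot_marks x (unmarked_cases x hx0 hx1 hx2 hx3 hx4)
    have inL : ∀ e : Fin 15, ∀ m : Fin 9, endsH1 e = s(x, m) → e ∈ L := fun e m he => by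
      by_contra hL
      exact h.closed e hL ⟨x, hx, by rw [he]; exact Sym2.mem_mk_left x m⟩ (Finset.mem_univ e)
    -- a non-root mark at `x` must be `v`
    have isv : ∀ e : Fin 15, ∀ m : Fin 9, endsH1 e = s(x, m) → (m = 0 ∨ m = 3 ∨ m = 4) → m = v :=
      fun e m he hm => by
        rcases h.ends_in e (inL e m he) m (by rw [he]; exact Sym2.mem_mk_right x m) with
          hI' | hv | h1 | h2
        · exact absurd hI' (mark_not_mem h.unmarked (by rcases hm with rfl | rfl | rfl <;> simp))
        · exact hv
        · exact absurd h1 (by rcases hm with rfl | rfl | rfl <;> decide)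
        · exact absurd h2 (by rcases hm with rfl | rfl | rfl <;> decide)
    exact h12 ((isv _ _ he₁ hm₁).trans (isv _ _ he₂ hm₂).symm)
  · -- `I = ∅`: every edge of `L` is `v–a₁` or `v–a₂`, so `|L| ≤ 2`
    push Not at hI
    have sub : L ⊆ Finset.univ.filter fun e : Fin 15 => endsH1 e = s(v, 1) ∨ endsH1 e = s(v, 2) := by
      intro g hg
      refine Finset.mem_filter.2 ⟨Finset.mem_univ g, edge_of_ends_in_triple g v fun x hx => ?_⟩
      rcases h.ends_in g hg x hx with hI' | hv | h1 | h2
      · exact absurd hI' (hI x)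
      · exact Or.inl hv
      · exact Or.inr (Or.inl h1)
      · exact Or.inr (Or.inr h2)
    have := (Finset.card_le_card sub).trans (card_root_edges_le_two v)
    have := h.three_le
    omega

/-! ## The configurations -/

/-- The badly crossed configuration `y–a₁, y–a₃, z–a₂, z–b`. -/
def xBad : Config (Fin 15) := fun e => decide (e = 7 ∨ e = 9 ∨ e = 12 ∨ e = 14)

/-- It lies below the typed configuration. -/
theorem xBad_le : xBad ≤ zF FH1 (fun _ => false) := by
  rw [Pi.le_def]; decide

/-- It is badly crossed. -/
theorem xBad_bad : RootBridge.BadlyCrossedConf endsH1 0 1 2 3 4 xBad := by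
  refine ⟨⟨?_, ?_, ?_⟩, ?_, ?_⟩ <;> decide +kernel

/-- The instance is not mild. -/
theorem notMildH1 : ¬ RootBridge.MildInst endsH1 0 1 2 3 4 FH1 (fun _ => false) := fun h =>
  h.not_bad xBad xBad_le xBad_bad

/-- The configuration `o–u, u–a₁`: `o` reaches `a₁` without `a₃`. -/
def xO : Config (Fin 15) := fun e => decide (e = 0 ∨ e = 3)

/-- It lies below the typed configuration. -/
theorem xO_le : xO ≤ zF FH1 (fun _ => false) := by
  rw [Pi.le_def]; decide

/-- `o` is not behind `a₃`. -/
theorem notOBehindH1 : ¬ RootBridge.OBehindA3 endsH1 0 1 2 3 FH1 (fun _ => false) := fun h =>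
  absurd ((h.behind xO xO_le).1 (by decide +kernel)) (by decide +kernel)

/-! ## The twelve conditions -/

/-- The twelve conditions of `ResidualCoreNHatCTBRASUDO7` on the (HARRIS-1) instance. -/
theorem instanceH1_mem12 : ResidualCoreNHatCTBRASUDO7 endsH1 0 1 2 3 4 FH1 :=
  ⟨(ResidualCoreNHatCTBRASUDO_iff endsH1 0 1 2 3 4 FH1).2
    ⟨coreH1, noHatsH1, noRootCutH1, noTwoTerminalH1, noRootBundleH1, noCutRootsH1, noCutRootsA3_H1,
      noOneStarH1, notMildH1, by decide, notOBehindH1⟩, by decide⟩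


end NonVacuityH1

end TypedRed

end CovForm

end Summit.Ventures.PercRepro2
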